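import Summits.BirchSwinnertonDyer.BirchSwinnertonDyer.Theses.KatoDescentTamePotSupersingular
import Summits.BirchSwinnertonDyer.Rank1Residual.O6.X3KatoMemberBound
import Literature.NumberTheory.EllipticCurves.NonEisensteinPrimeOfSurjective
import HarnessLib

/-!
# Route `KatoDescentTamePotSupersingular` (rung K8, sub-rung B4 (t′), cell `bsd-potss`): the load-bearing
# support `TameRankZeroAssembly` — PROVED (item stmt-BirchSwinnertonDyer-19983)

The rank-`0` ASSEMBLY on the COVERED tame potentially-supersingular rows (`p` odd additive, `f_p = 2`,
`e ∤ p − 1`): granted the lower-half crux `TameLowerHalfRankZero` (L₀), Kato's member bound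
`ReducibleKatoMember` (M) and the five published inputs `PublishedInputsTame` (Kato 2004 Thm. 14.5 (3)
under (12.5.2), Gross–Zagier–Kolyvagin, modularity, Cassels, Cassels–Tate), every (t′) pair `(W, p)` of
analytic rank `0` on a covered row has `ord_p #Ш = ord_p #Ш_an` (`Typed.MissingPPartAt W p`):
* branch A (`p`-adic tower surjective, `p ∤ Tam`, a modular parametrisation with `p ∤ c_D`): tower
  surjectivity at level `p¹` gives `E[p]` irreducible, so the pair is in `ClassX4`; `(t′)` gives
  `ord_p j ≥ 0` (`ClassO5.padicValRat_j_nonneg`); the tree's `X4RankZero.missingPPartAt_iff_lower_of_kato`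
  (Kato's upper half) reduces the missing `p`-part to L₀;
* branch B (`E[p]` reducible, no `ℤ/p²` in the class, `ord_p #Ш_an` even): the tree's
  `O6.x3PotGoodRankZeroUpperOfSmallClassTorsion_of_katoMember` (M + Cassels + Cassels–Tate parity, every
  odd additive potentially good `p`) gives the upper half, and `missingPPartAt_of_lower_of_upper` joins
  it with L₀.
Pure bookkeeping over tree theorems (pattern = the K9 item `wildRankZeroAssembly_proof`, p408759);
nothing about L₀ or M is asserted (they are hypotheses of the support). Seat `bsd-potss-kmc` generation 6.
-/

set_option autoImplicit false
-- sibling precedent (`KatoDescentPotSupersingularAssembly.lean`): the directory name repeats the summit name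
set_option linter.dupNamespace false

noncomputable section

open scoped Classical

namespace Summit.BirchSwinnertonDyer.BirchSwinnertonDyer.Theorems

open WeierstrassCurve Literature.NumberTheory.EllipticCurves
  Literature.NumberTheory.EllipticCurves.Rank1Residual
  Literature.NumberTheory.EllipticCurves.Rank1Residual.Typed
  Summit.BirchSwinnertonDyer.Rank1Residual.Additive
  Summit.BirchSwinnertonDyer.Rank1Residual
  Summit.BirchSwinnertonDyer.BirchSwinnertonDyer.Theses.KatoDescentTamePotSupersingular

/-- **The K8(t′) support `TameRankZeroAssembly`, proved** (route `KatoDescentTamePotSupersingular`,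
item stmt-BirchSwinnertonDyer-19983): on the covered tame rank-`0` rows, L₀ + Kato's upper half
(branch A, `X4RankZero.missingPPartAt_iff_lower_of_kato`) resp. L₀ + the member bound with
Cassels–Tate parity (branch B, `O6.x3PotGoodRankZeroUpperOfSmallClassTorsion_of_katoMember`) give
`MissingPPartAt W p`. [cite: Kato2004Asterisque, Thm. 14.5 (3) (p. 236)] [cite: Miller2011LMS, §1 and Def. 1.1] -/
theorem tameRankZeroAssembly_proof :
    Summit.BirchSwinnertonDyer.BirchSwinnertonDyer.Theses.KatoDescentTamePotSupersingular.TameRankZeroAssembly := by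
  intro hL hM hP W _ _ p _ hr hp2 hadd hT hcov
  obtain ⟨hKato, hGZK, hmod, hCassels, hCT⟩ := hP
  have hlow : MissingLowerBoundAt W p := hL W p hr hp2 hadd hT
  have hO5 : ClassO5 W p := ⟨hp2, hadd, Or.inr hT⟩
  have hpot : 0 ≤ padicValRat p W.j := hO5.padicValRat_j_nonneg
  rcases hcov with ⟨hsurj, htam, N, hN, D, hc⟩ | ⟨hred, hsmall, heven⟩
  · -- branch A: covered by Kato 14.5 (3) under (12.5.2) — the missing input IS the lower half
    haveI := hN
    haveI : NeZero (p : ℚ) := ⟨by exact_mod_cast (Fact.out : p.Prime).ne_zero⟩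
    have hirr : W.HasIrreducibleModPGaloisRep p := by
      have h1 := hsurj 1
      simp only [pow_one] at h1
      exact hasIrreducibleModPGaloisRep_of_hasSurjectiveModNGaloisRep W p (by exact_mod_cast h1)
    have hX : ClassX4 W p := ⟨hp2, hadd, hirr⟩
    exact (X4RankZero.missingPPartAt_iff_lower_of_kato W p hKato hGZK hmod hr hX hpot hsurj htam D
      hc).mpr hlow
  · -- branch B: reducible rows — Kato's member bound + Cassels–Tate parity give the upper half
    exact missingPPartAt_of_lower_of_upper W p hlow
      (O6.x3PotGoodRankZeroUpperOfSmallClassTorsion_of_katoMember hM hCassels hCT hGZK hmod W p hp2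
        hadd.1 hadd.2 hpot hred hr hsmall heven)

end Summit.BirchSwinnertonDyer.BirchSwinnertonDyer.Theorems

end
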